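import Literature.Analysis.FluidPDE.SelfSimilarLiouville
import Literature.Analysis.FluidPDE.ForwardDSSExistenceLocal
import Literature.Analysis.FluidPDE.ForwardDSSApproximation
import Literature.Analysis.FluidPDE.ForwardDSSLocalEnergy
import HarnessLib

/-!
# Sibling proof file of `SelfSimilarLiouville.lean`

Trunk: FluidKinetic (topic `Literature/Analysis/FluidPDE`). D-0014: named facts `def X : Prop`
of `Literature.Analysis.FluidPDE.SelfSimilarLiouville` are discharged or related here by
`theorem`s, leaving the fact file's declarations untouched.

* `Literature.Analysis.FluidPDE.knss_axisymmetric_no_swirl'_of_knss_axisymmetric_no_swirl`: the `ℝ³`-valued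
  slice-wise constancy `knss_axisymmetric_no_swirl'` ("every slice `u(t)`, `t < 0`, of a bounded
  ancient mild solution which is axisymmetric with no swirl is a.e. a constant vector `b ∈ ℝ³`",
  recorded `[folklore]` in the fact file) follows from Koch–Nadirashvili–Seregin–Šverák's
  Theorem 5.2 as rendered by `knss_axisymmetric_no_swirl` ("`u(x,t) = (0, 0, b₃(t))`": every
  slice is a.e. `β • e_z`) by taking `b = β • e_z`. This is the interim proof of
  `knss_axisymmetric_no_swirl'`, which the M5 import had to drop when
  `knss_axisymmetric_no_swirl` became a named fact; it is restored as an implication between the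
  two named facts (the pattern of `chae_wolf_dss_existence_of_bradshawTsai2019` in the fact file).

* `chae_wolf_dss_existence_of_scheme_of_limit_4_3_local` (and the `bradshawTsai2019_…`,
  `chaeWolf2018_…` variants): **status of the discharge of `chae_wolf_dss_existence`**
  (= Bradshaw–Tsai, Analysis & PDE 12 (2019), Thm 1.2, through
  `chae_wolf_dss_existence_of_bradshawTsai2019`). The printed proof's architecture is vendored in
  `ForwardDSSExistence.lean` / `ForwardDSSExistenceLocal.lean` (Lemma 4.1, Prop. 3.1 with DSS
  pressures, the localized limit step of §4.3, with the assembly and the re-scaling argument of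
  §4.2–§4.3 proved); of its three leaves, **Lemma 4.1 is discharged**
  (`bradshawTsai2019_lemma_4_1_holds`, `ForwardDSSApproximation.lean`) and Prop. 3.1 is reduced to
  the facts about the [BT1] scheme printed on pp. 8–10 (`bradshawTsai2019_prop_3_1_scheme`, with
  the continuity argument (3.13) ⇒ (3.14) proved, `ForwardDSSLocalEnergy.lean`). Hence, as of this
  file, `chae_wolf_dss_existence` follows from the two named facts
  `bradshawTsai2019_prop_3_1_scheme` ([BT1]'s construction and the estimates (3.9)–(3.12)) and
  `bradshawTsai2019_limit_4_3_local` (compactness on the unit cylinder, lower semicontinuity of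
  the local energy inequality, datum; itself being reduced to the DSS-free
  `bradshawTsai2019_cylinderLimit` in `ForwardDSSCylinderLimit*.lean`). The theorem
  `chae_wolf_dss_existence_holds` is not yet available: both remaining facts rest on a
  weak-solution theory of the Navier–Stokes equations (Galerkin scheme for the time-periodic Leray
  system, Calderón–Zygmund bounds for the pressure, Rellich–Lions compactness) that neither Mathlib
  nor `Literature` has at present.

## References

* G. Koch, N. Nadirashvili, G. Seregin, V. Šverák, *Liouville theorems for the Navier–Stokes
  equations and applications*, Acta Math. 203 (2009) 83–105, arXiv:0709.3599, Thm 5.2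
  [KochNadirashviliSereginSverak2009].
* Z. Bradshaw, T.-P. Tsai, *Discretely self-similar solutions to the Navier–Stokes equations with
  data in `L²_loc` satisfying the local energy inequality*, Analysis & PDE 12 (2019) 1943–1962,
  arXiv:1801.08060, Thm 1.2 and §2–§4 [BradshawTsai2019].
* Z. Bradshaw, T.-P. Tsai, Ann. Henri Poincaré 18 (2017) = arXiv:1510.07504, Thm 1.2
  [BradshawTsai2017AHP].
-/

noncomputable section

open MeasureTheory

namespace Literature.Analysis.FluidPDE

/-- `knss_axisymmetric_no_swirl'` (slices a.e. equal to a constant vector `b ∈ ℝ³`) is a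
corollary of KNSS's Theorem 5.2 as rendered by `knss_axisymmetric_no_swirl` (slices a.e. equal
to `β • e_z`): take `b = β • e_z`. [cite: KochNadirashviliSereginSverak2009, Thm 5.2] -/
theorem knss_axisymmetric_no_swirl'_of_knss_axisymmetric_no_swirl
    (h : knss_axisymmetric_no_swirl) : knss_axisymmetric_no_swirl' := by
  intro u hu hmeas haxi hswirl t ht
  obtain ⟨β, hβ⟩ := h hu hmeas haxi hswirl t ht
  exact ⟨β • FluidPDE.eZ, hβ⟩

/-! ## Status of the discharge of `chae_wolf_dss_existence` (Bradshaw–Tsai 2019, Thm 1.2) -/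

/-- **Bradshaw–Tsai 2019, Thm 1.2, from the two remaining named facts**: the scheme facts behind
Prop. 3.1 (`bradshawTsai2019_prop_3_1_scheme`, arXiv:1801.08060 pp. 8–10, with [BT1] Thm 1.2) and
the localized passage to the limit of §4.3 (`bradshawTsai2019_limit_4_3_local`) imply
`bradshawTsai2019_dss_existence`; Lemma 4.1 enters through its discharge
`bradshawTsai2019_lemma_4_1_holds` and Prop. 3.1 (with DSS pressures) through the proved
`bradshawTsai2019_prop_3_1_dss_of_scheme`. [cite: BradshawTsai2019, Thm 1.2 with §3–§4] -/
theorem bradshawTsai2019_dss_existence_of_scheme_of_limit_4_3_local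
    (h31 : bradshawTsai2019_prop_3_1_scheme) (h43 : bradshawTsai2019_limit_4_3_local) :
    bradshawTsai2019_dss_existence :=
  bradshawTsai2019_dss_existence_of_local_parts bradshawTsai2019_lemma_4_1_holds
    (bradshawTsai2019_prop_3_1_dss_of_scheme h31) h43

/-- **Status of `chae_wolf_dss_existence`**: it follows from `bradshawTsai2019_prop_3_1_scheme` and
`bradshawTsai2019_limit_4_3_local` (via `chae_wolf_dss_existence_of_bradshawTsai2019`; Lemma 4.1
discharged, the assembly, the re-scaling argument and the continuity argument proved in the
tree). [cite: BradshawTsai2019, Thm 1.2] -/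
theorem chae_wolf_dss_existence_of_scheme_of_limit_4_3_local
    (h31 : bradshawTsai2019_prop_3_1_scheme) (h43 : bradshawTsai2019_limit_4_3_local) :
    chae_wolf_dss_existence :=
  chae_wolf_dss_existence_of_bradshawTsai2019
    (bradshawTsai2019_dss_existence_of_scheme_of_limit_4_3_local h31 h43)

/-- Likewise the rendered Chae–Wolf existence statement `chaeWolf2018_dss_existence`
(Bradshaw–Tsai 2019, Comments on Thm 1.2: "a slight refinement of the main result of [Chae–Wolf]").
[cite: BradshawTsai2019, Comments on Thm 1.2] -/
theorem chaeWolf2018_dss_existence_of_scheme_of_limit_4_3_local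
    (h31 : bradshawTsai2019_prop_3_1_scheme) (h43 : bradshawTsai2019_limit_4_3_local) :
    chaeWolf2018_dss_existence :=
  chaeWolf2018_dss_existence_of_bradshawTsai2019
    (bradshawTsai2019_dss_existence_of_scheme_of_limit_4_3_local h31 h43)

end Literature.Analysis.FluidPDE

end
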